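import Mathlib
import Literature.AlgebraicGeometry.Modules.ExtCohomologyComparison
import Literature.AlgebraicGeometry.Morphisms.CechModuleRefinement
import Summits.ResolutionOfSingularities.ResolutionOfSingularities.Theorems.HomologicalConductorNoZenoFullSheafDualExtend
import Summits.ResolutionOfSingularities.ResolutionOfSingularities.Theorems.HomologicalConductorNoZenoDualFreeCech
import HarnessLib

/-!
# Crux `NoZenoR` (stmt-ResolutionOfSingularities-19943), line `sandwich-cluster`, G-layer G2 (vii), part 3:
# `Ext¹_T(M, T) = 0 ⇒ Ȟ¹(𝒰, M~^∨) = 0` (the special / (W) clause)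

OURS (cell res-hironaka, chain W4.4; G2 «full-sheaf package» clause (vii) of the holder's cut,
res-D-pv-045 AS res-L0-w44-stub-8 `SketchG2Split.lean` v2 3e6b2bba3e81173a; seat res-D-pv-024).
Nothing of [claim: Hironaka2017] is used; AI-written, weaker than expert review.

**`fullSheaf_dual_cechMH1_subsingleton`** — for `T` a Noetherian normal domain, `π : X ⟶ Spec T` a
resolution with `Ȟ¹(𝒰, 𝒪_X) = 0` on finite affine covers (`HasTrivialCechH1`), `M` a finite `T`-module
with `Ext¹_T(M, T) = 0`, `φ : M →+ K(X)^r` injective and `T`-semilinear, and `M~ = 𝒪_X · φ(M)`: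
**`Ȟ¹(𝒰, M~^∨) = 0`** on every finite affine open cover (`M~^∨ = 𝓗om(M~, 𝒪_X)`, the tree's
`Modules.dual`). This is (e)⇒(d) of Iyama–Wemyss, *The classification of special Cohen–Macaulay
modules*, Math. Z. 265 (2010), Thm. 2.7 (Wunram/Riemenschneider: `M` SPECIAL iff `H¹(M~^∨) = 0`), by the
(B4) chase of the chain's THEOREM Q-rat — with NO local freeness of `M~` needed: dualise the
presentation `0 → 𝒦 → 𝒪_X^n → M~ → 0` to the left exact `0 → M~^∨ → (𝒪_X^n)^∨ → 𝒦^∨`; a Čech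
cocycle `z` of `M~^∨` becomes a coboundary `d⁰b` in `(𝒪_X^n)^∨` (`Ȟ¹ = 0` there by rationality,
`subsingleton_cechMH1_dual_freeMod`); the images of the `b_i` in `𝒦^∨` glue to a GLOBAL form
`t : 𝒦 → 𝒪_X`, which extends to `ψ : 𝒪_X^n → 𝒪_X` (`exists_comp_kernel_ι_eq_of_forall_ext_one_eq_zero`,
the (W)-step, from `Ext¹_T(M, T) = 0`); `b - ψ|` dies in `𝒦^∨`, so comes from `M~^∨` (cokernel
property of `q|_{U_i}`), and `z` is its coboundary (`q^∨` is injective on sections).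
Compared with the holder's typed (vii) v2 the binders `hdim`, `h24`, `hM` are NOT needed and dropped.

References: O. Iyama, M. Wemyss, Math. Z. 265 (2010) 41–83, Thm. 2.7 [`IyamaWemyss2009`];
J. Wunram, Math. Ann. 279 (1988) 583–598 [`Wunram1988`]; M. Artin, J.-L. Verdier, Math. Ann. 270
(1985), (1.1) [`ArtinVerdier1985`].
-/

-- single-problem summit: the doubled namespace component `ResolutionOfSingularities` is forced
set_option linter.dupNamespace false

noncomputable section

universe u

open CategoryTheory CategoryTheory.Limits AlgebraicGeometry TopologicalSpace Opposite
open Literature.AlgebraicGeometry.Resolution Literature.AlgebraicGeometry.Morphisms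
open Literature.AlgebraicGeometry.Modules Literature.AlgebraicGeometry.Motives

namespace Summit.ResolutionOfSingularities.ResolutionOfSingularities.Theorems.NoZeno.SandwichCluster.FullSheaf

variable {X : Scheme.{u}}

/-! ## Čech bookkeeping -/

section Cech

variable {A : Type u} [CommRing A] (f : X ⟶ Spec (.of A)) {ι : Type} (U : ι → X.Opens)

/-- `φ` on `1`-cochains is compatible with composition. [this work] -/
theorem cechMapC1_comp {M N P : X.Modules} (φ : M ⟶ N) (ψ : N ⟶ P) (c : CechMC1 f M U) :
    cechMapC1 f (φ ≫ ψ) U c = cechMapC1 f ψ U (cechMapC1 f φ U c) := rfl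

/-- `φ` on `0`-cochains is compatible with composition. [this work] -/
theorem cechMapC0_comp {M N P : X.Modules} (φ : M ⟶ N) (ψ : N ⟶ P) (b : CechMC0 f M U) :
    cechMapC0 f (φ ≫ ψ) U b = cechMapC0 f ψ U (cechMapC0 f φ U b) := rfl

/-- The restrictions of a global section form a `0`-cochain with zero Čech differential. [this work] -/
theorem cechMD0_res_eq_zero {M : X.Modules} (s : MSections f M ⊤) :
    cechMD0 f M U (fun i => MSections.res f M (le_top : U i ≤ ⊤) s) = 0 := by
  funext i j
  rw [cechMD0_apply, MSections.res_res, MSections.res_res, sub_self]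
  rfl

/-- If `φ` is injective on the sections over the `U_i ∩ U_j`, then `φ` is injective on `1`-cochains.
[this work] -/
theorem cechMapC1_injective {M N : X.Modules} (φ : M ⟶ N)
    (h : ∀ i j, Function.Injective (MSections.app f φ (U i ⊓ U j))) :
    Function.Injective (cechMapC1 f φ U) := by
  intro c c' hcc'
  funext i j
  exact h i j (by rw [← cechMapC1_apply, ← cechMapC1_apply, hcc'])

end Cech

/-! ## The dual presentation sequence on sections -/

section DualSeq

variable {P E : X.Modules} (q : P ⟶ E) [Epi q]

/-- **`q^∨` is injective on sections**: for an epimorphism `q : P ⟶ E` and an open `W`, pre-composition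
with `q|_W` is injective on `Γ(W, 𝓗om(E, N)) = (E|_W ⟶ N|_W)` (restriction to `W` is exact, so `q|_W`
is an epimorphism). [this work] -/
theorem sheafHomMapLeft_app_injective_of_epi (N : X.Modules) (W : X.Opens) :
    Function.Injective ((sheafHomMapLeft q N).app W) := by
  have hS : (ShortComplex.mk (kernel.ι q) q (kernel.condition q)).ShortExact :=
    ShortComplex.ShortExact.mk' (ShortComplex.exact_of_f_is_kernel _ (kernelIsKernel _))
      inferInstance inferInstance
  haveI := (Scheme.Modules.shortExact_map_overFunctor hS W).epi_g
  intro ψ ψ' h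
  have h' : (SheafOfModules.overFunctor _ W).map q ≫ (show E.over W ⟶ N.over W from ψ) =
      (SheafOfModules.overFunctor _ W).map q ≫ (show E.over W ⟶ N.over W from ψ') := h
  exact (cancel_epi ((ShortComplex.mk (kernel.ι q) q (kernel.condition q)).map
    (Scheme.Modules.overFunctor W)).g).mp h'

/-- **Exactness of `E^∨ → P^∨ → 𝒦^∨` on sections** (`𝒦 = ker q`): a form `β : P|_W → N|_W` which
vanishes on `𝒦|_W` factors through `q|_W` (the cokernel of `𝒦|_W → P|_W`, restriction being exact).
[this work] -/
theorem exists_sheafHomMapLeft_app_eq_of_kernel (N : X.Modules) (W : X.Opens)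
    (β : Γ(sheafHom P N, W)) (hβ : (sheafHomMapLeft (kernel.ι q) N).app W β = 0) :
    ∃ γ : Γ(sheafHom E N, W), (sheafHomMapLeft q N).app W γ = β := by
  have hS : (ShortComplex.mk (kernel.ι q) q (kernel.condition q)).ShortExact :=
    ShortComplex.ShortExact.mk' (ShortComplex.exact_of_f_is_kernel _ (kernelIsKernel _))
      inferInstance inferInstance
  have hSW := Scheme.Modules.shortExact_map_overFunctor hS W
  have hβ' : ((ShortComplex.mk (kernel.ι q) q (kernel.condition q)).map
      (Scheme.Modules.overFunctor W)).f ≫ (show P.over W ⟶ N.over W from β) = 0 := hβ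
  refine ⟨(show Γ(sheafHom E N, W) from hSW.gIsCokernel.desc (CokernelCofork.ofπ _ hβ')), ?_⟩
  exact hSW.gIsCokernel.fac (CokernelCofork.ofπ _ hβ') WalkingParallelPair.one

end DualSeq

/-! ## G2 (vii): `Ȟ¹(𝒰, M~^∨) = 0` -/

/-- **The Čech chase** (generators fixed): with the notation of the file docstring, for every finite affine
open cover `𝒰` of `X`, `Ȟ¹(𝒰, M~^∨) = 0`. [this work] -/
theorem fullSheaf_dual_cechMH1_subsingleton_of_generators (T : Type) [CommRing T] [IsDomain T]
    [IsNoetherianRing T] [IsIntegrallyClosed T] (X : Scheme.{0}) [IsIntegral X] [IsLocallyNoetherian X]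
    (π : X ⟶ Spec (.of T)) (M : Type) [AddCommGroup M] [Module T M] {r : ℕ}
    (φ : M →+ (Fin r → X.functionField)) (hπ : IsResolution π) (hrat : HasTrivialCechH1 π)
    (hW : ∀ e : Abelian.Ext (ModuleCat.of T M) (ModuleCat.of T T) 1, e = 0)
    (hφ : ∀ (a : T) (m : M), φ (a • m) = baseToFunctionField π a • φ m)
    (hφinj : Function.Injective φ) {n : ℕ} (m : Fin n → M) (hm : Submodule.span T (Set.range m) = ⊤)
    {ι : Type} [Finite ι] (U : ι → X.Opens) (hU : ∀ i, IsAffineOpen (U i)) (hcov : ⨆ i, U i = ⊤) :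
    Subsingleton (CechMH1 π (dual (generatedSheaf (Fin r → X.functionField) (Set.range φ))) U) := by
  -- the presentation `q : 𝒪_X^n ↠ M~` attached to the generators, `κ : 𝒦 = ker q ↪ 𝒪_X^n`
  haveI : Epi (presentation (X := X) (Fin r → X.functionField) (Set.range φ)
      (fun k => (⟨φ (m k), m k, rfl⟩ : Set.range φ))) :=
    epi_presentation _ _ _ fun W hW hWn => by
      haveI := hWn
      exact span_range_ofMem_generators_eq_top (X := X) π φ hφ m hm hW
  -- the dual maps `q^∨ : M~^∨ → P^∨`, `κ^∨ : P^∨ → 𝒦^∨`, with `q^∨ ≫ κ^∨ = 0`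
  have hqκ : sheafHomMapLeft (presentation (X := X) (Fin r → X.functionField) (Set.range φ)
      (fun k => (⟨φ (m k), m k, rfl⟩ : Set.range φ))) (unitModule X) ≫ sheafHomMapLeft (kernel.ι (presentation (X := X) (Fin r → X.functionField) (Set.range φ)
      (fun k => (⟨φ (m k), m k, rfl⟩ : Set.range φ)))) (unitModule X) = 0 := by
    rw [← sheafHomMapLeft_comp, kernel.condition, sheafHomMapLeft_zero]
  -- `Ȟ¹(𝒰, P^∨) = 0`
  have hP : Subsingleton (CechMH1 π (dual (freeMod X n)) U) :=
    subsingleton_cechMH1_dual_freeMod π U n (hrat ι U hU hcov)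
  refine subsingleton_of_forall_eq 0 fun y => ?_
  obtain ⟨z, rfl⟩ := CechMH1.mk_surjective π _ U y
  rw [CechMH1.mk_eq_zero_iff, mem_cechMB1_iff]
  -- step 1: `q^∨ z = d⁰ b`
  have h1 : cechMapH1 π (sheafHomMapLeft (presentation (X := X) (Fin r → X.functionField) (Set.range φ)
      (fun k => (⟨φ (m k), m k, rfl⟩ : Set.range φ))) (unitModule X)) U (CechMH1.mk π _ U z) = 0 :=
    Subsingleton.elim _ _
  rw [cechMapH1_mk, CechMH1.mk_eq_zero_iff, cechMapZ1_coe, mem_cechMB1_iff] at h1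
  obtain ⟨b, hb⟩ := h1
  -- step 2: the `κ^∨ b_i` glue to a global section of `𝒦^∨`, i.e. a form `t : 𝒦 → 𝒪_X`
  have ht0 : cechMD0 π _ U (cechMapC0 π (sheafHomMapLeft (kernel.ι (presentation (X := X) (Fin r → X.functionField) (Set.range φ)
      (fun k => (⟨φ (m k), m k, rfl⟩ : Set.range φ)))) (unitModule X)) U b) = 0 := by
    rw [cechMD0_mapC0, hb, ← cechMapC1_comp, hqκ]
    funext i j
    rw [cechMapC1_apply, MSections.app_zero]
    rfl
  obtain ⟨Tg, hTg⟩ := MSections.exists_res_eq π (dual (kernel (presentation (X := X) (Fin r → X.functionField) (Set.range φ)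
      (fun k => (⟨φ (m k), m k, rfl⟩ : Set.range φ))))) U (fun i => (le_top : U i ≤ ⊤))
    hcov.ge (cechMapC0 π (sheafHomMapLeft (kernel.ι (presentation (X := X) (Fin r → X.functionField) (Set.range φ)
      (fun k => (⟨φ (m k), m k, rfl⟩ : Set.range φ)))) (unitModule X)) U b) fun i j => by
      have h := congrFun (congrFun ht0 i) j
      rw [cechMD0_apply, Pi.zero_apply, Pi.zero_apply, sub_eq_zero] at h
      exact h.symm
  -- step 3: extend `t` over `κ` to `ψ : 𝒪_X^n → 𝒪_X` (`Ext¹_T(M, T) = 0`)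
  obtain ⟨ψ, hψ⟩ := exists_comp_kernel_ι_eq_of_forall_ext_one_eq_zero π φ hπ hW hφ hφinj m hm
    (homOfTop (show (kernel (presentation (X := X) (Fin r → X.functionField) (Set.range φ)
      (fun k => (⟨φ (m k), m k, rfl⟩ : Set.range φ)))).over ⊤ ⟶ (unitModule X).over ⊤ from Tg))
  -- its global section `Ψ` of `P^∨`, and the `0`-cochain of its restrictions
  obtain ⟨Ψ, hΨ⟩ : ∃ Ψ : MSections π (dual (freeMod X n)) ⊤,
      Ψ = (show Γ(dual (freeMod X n), ⊤) from (SheafOfModules.overFunctor _ ⊤).map ψ) := ⟨_, rfl⟩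
  have hκΨ : MSections.app π (sheafHomMapLeft (kernel.ι (presentation (X := X) (Fin r → X.functionField) (Set.range φ)
      (fun k => (⟨φ (m k), m k, rfl⟩ : Set.range φ)))) (unitModule X)) ⊤ Ψ = Tg := by
    rw [hΨ, MSections.app_apply, sheafHomMapLeft_app_apply]
    change (Scheme.Modules.overFunctor ⊤).map (kernel.ι (presentation (X := X) (Fin r → X.functionField) (Set.range φ)
      (fun k => (⟨φ (m k), m k, rfl⟩ : Set.range φ)))) ≫ (Scheme.Modules.overFunctor ⊤).map ψ = _
    rw [← Functor.map_comp, hψ]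
    exact overFunctor_map_homOfTop _
  -- step 4: `b - Ψ|` dies under `κ^∨`, hence comes from `M~^∨`: `b_i - Ψ|_{U_i} = q^∨ c_i`
  have hκb : ∀ i, (sheafHomMapLeft (kernel.ι (presentation (X := X) (Fin r → X.functionField) (Set.range φ)
      (fun k => (⟨φ (m k), m k, rfl⟩ : Set.range φ)))) (unitModule X)).app (U i)
      (b i - MSections.res π _ (le_top : U i ≤ ⊤) Ψ) = 0 := fun i => by
    change MSections.app π (sheafHomMapLeft (kernel.ι (presentation (X := X) (Fin r → X.functionField) (Set.range φ)
      (fun k => (⟨φ (m k), m k, rfl⟩ : Set.range φ)))) (unitModule X)) (U i)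
      (b i - MSections.res π _ (le_top : U i ≤ ⊤) Ψ) = 0
    rw [map_sub, ← MSections.res_app, hκΨ, hTg, cechMapC0_apply, sub_self]
  choose c hc using fun i => exists_sheafHomMapLeft_app_eq_of_kernel (presentation (X := X) (Fin r → X.functionField) (Set.range φ)
      (fun k => (⟨φ (m k), m k, rfl⟩ : Set.range φ))) (unitModule X) (U i) _ (hκb i)
  refine ⟨c, ?_⟩
  -- step 5: `q^∨ (d⁰ c) = d⁰ (b - Ψ|) = d⁰ b = q^∨ z`, and `q^∨` is injective on cochains
  apply cechMapC1_injective π U (sheafHomMapLeft (presentation (X := X) (Fin r → X.functionField) (Set.range φ)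
      (fun k => (⟨φ (m k), m k, rfl⟩ : Set.range φ))) (unitModule X))
    (fun i j => sheafHomMapLeft_app_injective_of_epi (presentation (X := X) (Fin r → X.functionField) (Set.range φ)
      (fun k => (⟨φ (m k), m k, rfl⟩ : Set.range φ))) (unitModule X) _)
  rw [← cechMD0_mapC0, ← hb]
  have hcb : cechMapC0 π (sheafHomMapLeft (presentation (X := X) (Fin r → X.functionField) (Set.range φ)
      (fun k => (⟨φ (m k), m k, rfl⟩ : Set.range φ))) (unitModule X)) U c =
      b - fun i => MSections.res π _ (le_top : U i ≤ ⊤) Ψ := by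
    funext i
    rw [cechMapC0_apply, Pi.sub_apply]
    exact hc i
  rw [hcb, map_sub, cechMD0_res_eq_zero, sub_zero]

/-- **G2 (vii): `Ext¹_T(M, T) = 0 ⇒ Ȟ¹(𝒰, M~^∨) = 0`** on every finite affine open cover — the typed
target `fullSheaf_dual_cechMH1_subsingleton` of the holder's `SketchG2Split.lean` v2 WITHOUT the unneeded
binders `hdim`, `h24`, `hM` (reflexivity, the fibre dimension and `Ȟ²` play no role in (vii); only
`Ext¹(M, T) = 0`, rationality `Ȟ¹(𝒪_X) = 0`, `Γ(X, 𝒪_X) = T` and `K(X) = Frac T`). See the module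
docstring for the chase. [this work] -/
theorem fullSheaf_dual_cechMH1_subsingleton (T : Type) [CommRing T] [IsDomain T] [IsNoetherianRing T]
    [IsIntegrallyClosed T] (X : Scheme.{0}) [IsIntegral X] [IsLocallyNoetherian X]
    (π : X ⟶ Spec (.of T)) (M : Type) [AddCommGroup M] [Module T M] [Module.Finite T M] {r : ℕ}
    (φ : M →+ (Fin r → X.functionField)) (hπ : IsResolution π) (hrat : HasTrivialCechH1 π)
    (hW : ∀ e : Abelian.Ext (ModuleCat.of T M) (ModuleCat.of T T) 1, e = 0)
    (hφ : ∀ (a : T) (m : M), φ (a • m) = baseToFunctionField π a • φ m)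
    (hφinj : Function.Injective φ)
    {ι : Type} [Finite ι] (U : ι → X.Opens) (hU : ∀ i, IsAffineOpen (U i)) (hcov : ⨆ i, U i = ⊤) :
    Subsingleton (CechMH1 π (dual (generatedSheaf (Fin r → X.functionField) (Set.range φ))) U) := by
  obtain ⟨n, m, hm⟩ := Module.Finite.exists_fin (R := T) (M := M)
  exact fullSheaf_dual_cechMH1_subsingleton_of_generators T X π M φ hπ hrat hW hφ hφinj m hm U hU hcov

end Summit.ResolutionOfSingularities.ResolutionOfSingularities.Theorems.NoZeno.SandwichCluster.FullSheaf

end
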